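import Summits.QuantumFields.YangMills.Theorems.ForcedResponseSkewnessResponseLocalisationFarCollar
import Mathlib.Analysis.SpecialFunctions.SmoothTransition
import Mathlib.Analysis.InnerProductSpace.Calculus
import Mathlib.Analysis.Calculus.ContDiff.RCLike
import Mathlib.Topology.Algebra.MetricSpace.Lipschitz
import Summits.QuantumFields.YangMills.Theorems.BalabanLadderUVSeamRecCeilingsPeriodClasses
import HarnessLib

/-!
# Route `ForcedResponseSkewness`, crux `ResponseLocalisation` (stmt-QuantumFields-24869), reserve line «signed-femto-collar»: toolkit

Helper file (`--supports stmt-QuantumFields-24869`, seat `ym-line-frs-p2` g6) for the crux-level reduction of the SIGNED smooth-collar share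
(design note = evidence #23 on the item):

* `exists_radial_profile` — for `0 < r₁ < R₀` a Lipschitz profile `F : ℝ → [0,1]`, `F = 1` on `(-∞, r₁]`, `F = 0` on `[R₀, ∞)`, such that
  `u ↦ F ‖u − c‖` is smooth on `ℝ⁴` for every centre `c` (`F(t) = smoothTransition((R₀ − t)/(R₀ − r₁))`; Lipschitz constant from
  `C¹ ⇒ locally Lipschitz` on the compact `[0,1]` and the clamp `projIcc`).  The radial cut-off `χ = F(‖· − p‖) + F(‖· − θp‖)` of the signed
  crux is built from it; its symmetric part about a near insertion `z` is the radial lattice weight of `SymContactKernelSigR`, its offset part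
  has sup `≤ Lip(F)·ρ` on one physical shell.
* `abs_torusK3_le_of_fbl` — the FBL-collar bound `|torusK3 x y z| ≤ (2C₁/M⁴)³` for three sites pairwise torus-separated by `2M+4` in some
  coordinate (explicit collar identity `Far.torusK3_eq_torusE_collar` + `Far.abs_collar_le`, p597430) — pays the offset shell.

Honest label: analysis helpers on a conditional rung line (leaf R2a `BalabanLadder.NT`); nothing here bears on NT or the YM mass gap, NOT proved.
-/

set_option autoImplicit false

noncomputable section

namespace Summit.QuantumFields.YangMills.Cruxes.ResponseLocalisation.Signed

open scoped ContDiff NNReal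
open Set Metric MeasureTheory
open Literature.MathematicalPhysics.QuantumFieldTheory Literature.MathematicalPhysics.QuantumLattice
open Literature.Probability.LatticeModels
open Summit.QuantumFields.YangMills.Cruxes.OSLegsFromFemtoAndGap.DlrCollarTransfer
open Summit.QuantumFields.YangMills.Cruxes.ResponseLocalisation.Far

/-! ## §1 A Lipschitz radial cut-off profile -/

/-- `Real.smoothTransition` is globally Lipschitz (it is `C¹` and constant off `[0,1]`). [folklore] -/
theorem exists_lipschitz_smoothTransition : ∃ K : ℝ≥0, LipschitzWith K Real.smoothTransition := by
  have hloc : LocallyLipschitz Real.smoothTransition :=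
    (Real.smoothTransition.contDiff (n := 1)).locallyLipschitz
  obtain ⟨K, hK⟩ := (hloc.locallyLipschitzOn (s := Icc (0 : ℝ) 1)).exists_lipschitzOnWith_of_compact isCompact_Icc
  refine ⟨K, LipschitzWith.of_dist_le_mul fun x y => ?_⟩
  have hx := hK (Set.projIcc (0 : ℝ) 1 zero_le_one x).2 (Set.projIcc (0 : ℝ) 1 zero_le_one y).2
  rw [edist_dist, edist_dist] at hx
  rw [← Real.smoothTransition.projIcc (x := x), ← Real.smoothTransition.projIcc (x := y)]
  have h1 : dist ((Set.projIcc (0 : ℝ) 1 zero_le_one x : ℝ)) (Set.projIcc (0 : ℝ) 1 zero_le_one y) ≤ dist x y := by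
    rw [Real.dist_eq, Real.dist_eq]
    exact Set.abs_projIcc_sub_projIcc zero_le_one
  have h2 : (ENNReal.ofReal (dist (Real.smoothTransition (Set.projIcc 0 1 zero_le_one x))
      (Real.smoothTransition (Set.projIcc 0 1 zero_le_one y)))) ≤
      (K : ENNReal) * ENNReal.ofReal (dist ((Set.projIcc (0 : ℝ) 1 zero_le_one x : ℝ)) (Set.projIcc (0 : ℝ) 1 zero_le_one y)) := hx
  have h3 : dist (Real.smoothTransition (Set.projIcc 0 1 zero_le_one x)) (Real.smoothTransition (Set.projIcc 0 1 zero_le_one y)) ≤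
      K * dist ((Set.projIcc (0 : ℝ) 1 zero_le_one x : ℝ)) (Set.projIcc (0 : ℝ) 1 zero_le_one y) := by
    have h4 : (K : ENNReal) * ENNReal.ofReal (dist ((Set.projIcc (0 : ℝ) 1 zero_le_one x : ℝ)) (Set.projIcc (0 : ℝ) 1 zero_le_one y)) =
        ENNReal.ofReal (K * dist ((Set.projIcc (0 : ℝ) 1 zero_le_one x : ℝ)) (Set.projIcc (0 : ℝ) 1 zero_le_one y)) := by
      rw [ENNReal.ofReal_mul (NNReal.coe_nonneg K), ENNReal.ofReal_coe_nnreal]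
    rw [h4] at h2
    exact (ENNReal.ofReal_le_ofReal_iff (by positivity)).1 h2
  exact h3.trans (mul_le_mul_of_nonneg_left h1 (NNReal.coe_nonneg K))

/-- **A Lipschitz radial cut-off profile.**  For `0 < r₁ < R₀` there is `F : ℝ → [0,1]`, `F = 1` on `(-∞, r₁]`, `F = 0` on `[R₀, ∞)`,
Lipschitz, with `u ↦ F ‖u − c‖` smooth on `ℝ⁴` for every centre `c`. [folklore] -/
theorem exists_radial_profile {r₁ R₀ : ℝ} (h0 : 0 < r₁) (h1 : r₁ < R₀) :
    ∃ F : ℝ → ℝ, ∃ LF : ℝ, 0 ≤ LF ∧ (∀ t, 0 ≤ F t) ∧ (∀ t, F t ≤ 1) ∧ (∀ t, t ≤ r₁ → F t = 1) ∧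
      (∀ t, R₀ ≤ t → F t = 0) ∧ (∀ t t', |F t - F t'| ≤ LF * |t - t'|) ∧
      ∀ c : EuclideanSpace ℝ (Fin 4), ContDiff ℝ ∞ (fun u : EuclideanSpace ℝ (Fin 4) => F ‖u - c‖) := by
  obtain ⟨K, hK⟩ := exists_lipschitz_smoothTransition
  have hd : 0 < R₀ - r₁ := by linarith
  set g : ℝ → ℝ := fun t => (R₀ - t) / (R₀ - r₁) with hg
  set F : ℝ → ℝ := fun t => Real.smoothTransition (g t) with hF
  refine ⟨F, K / (R₀ - r₁), by positivity, fun t => Real.smoothTransition.nonneg _, fun t => Real.smoothTransition.le_one _,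
    fun t ht => ?_, fun t ht => ?_, fun t t' => ?_, fun c => ?_⟩
  · -- `t ≤ r₁`: argument `≥ 1`
    apply Real.smoothTransition.one_of_one_le
    rw [hg, le_div_iff₀ hd]; linarith
  · -- `R₀ ≤ t`: argument `≤ 0`
    apply Real.smoothTransition.zero_of_nonpos
    rw [hg, div_nonpos_iff]; right; constructor <;> linarith
  · -- Lipschitz
    have h := hK.dist_le_mul (g t) (g t')
    rw [Real.dist_eq, Real.dist_eq] at h
    have hgg : |g t - g t'| = |t - t'| / (R₀ - r₁) := by
      rw [hg]
      have e : (R₀ - t) / (R₀ - r₁) - (R₀ - t') / (R₀ - r₁) = -(t - t') / (R₀ - r₁) := by field_simp; ring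
      rw [e, abs_div, abs_neg, abs_of_pos hd]
    rw [hgg] at h
    calc |F t - F t'| ≤ K * (|t - t'| / (R₀ - r₁)) := h
      _ = K / (R₀ - r₁) * |t - t'| := by ring
  · -- smoothness of `u ↦ F ‖u − c‖`
    rw [contDiff_iff_contDiffAt]
    intro u
    by_cases hu : u = c
    · -- near the centre the function is constant `= 1`
      subst hu
      have hev : (fun v : EuclideanSpace ℝ (Fin 4) => F ‖v - u‖) =ᶠ[nhds u] fun _ => (1 : ℝ) := by
        have hball : Metric.ball u r₁ ∈ nhds u := Metric.ball_mem_nhds u h0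
        filter_upwards [hball] with v hv
        rw [Metric.mem_ball, dist_eq_norm] at hv
        show Real.smoothTransition (g ‖v - u‖) = 1
        apply Real.smoothTransition.one_of_one_le
        rw [hg, le_div_iff₀ hd]; linarith
      exact (contDiffAt_const (c := (1 : ℝ))).congr_of_eventuallyEq hev
    · have hne : u - c ≠ 0 := sub_ne_zero.2 hu
      have hnorm : ContDiffAt ℝ ∞ (fun v : EuclideanSpace ℝ (Fin 4) => ‖v - c‖) u :=
        (contDiffAt_id.sub contDiffAt_const).norm ℝ hne
      have hg' : ContDiff ℝ ∞ g := by
        rw [hg]; exact (contDiff_const.sub contDiff_id).div_const _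
      exact Real.smoothTransition.contDiffAt.comp u (hg'.contDiffAt.comp u hnorm)

/-! ## §2 The FBL-collar bound for a separated triple -/

section Torus

variable (G : Type) [Group G] [TopologicalSpace G] [IsTopologicalGroup G] [CompactSpace G]
  [MeasurableSpace G] [BorelSpace G] (r : LatticeRep G)

/-- **FBL-collar bound on the torus third cumulant of a separated triple**: under the femto boundary law at `β` (constants `C₁, ℓ₁, p`,
cubes `b·aβ ≤ ℓ₁`), for `1 ≤ M`, `(2M+3)aβ ≤ ℓ₁`, `4M+8 ≤ L` and three sites pairwise torus-separated by `2M+4` in some coordinate,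
`|torusK3_{β,L}(x,y,z)| ≤ (2C₁/M⁴)³` (`torusK3 = E_T[h_x h_y h_z]`, `|h| ≤ 2C₁/M⁴`). [folklore] -/
theorem abs_torusK3_le_of_fbl (β : ℝ) {aβ C₁ ℓ₁ p : ℝ} (hC₁ : 0 ≤ C₁)
    (hF : ∀ (c : Fin 4 → ℤ) (b : ℕ), (b : ℝ) * aβ ≤ ℓ₁ → ∀ (η : LGConfig 4 G) (w : Fin 4 → ℤ),
      2 ≤ depth c b w → |kerE G r β c b η (dens G r w) - p| ≤ C₁ / (depth c b w : ℝ) ^ 4)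
    {L M : ℕ} (hM : 1 ≤ M) (hb : ((2 * M + 3 : ℕ) : ℝ) * aβ ≤ ℓ₁) (hML : 4 * M + 8 ≤ L) (x y z : Fin 4 → ℤ)
    (hxy : ∃ k : Fin 4, (2 * (M : ℤ) + 4) ≤ |((((x k - y k : ℤ) : ZMod (2 * L + 1))).valMinAbs : ℤ)|)
    (hxz : ∃ k : Fin 4, (2 * (M : ℤ) + 4) ≤ |((((x k - z k : ℤ) : ZMod (2 * L + 1))).valMinAbs : ℤ)|)
    (hyz : ∃ k : Fin 4, (2 * (M : ℤ) + 4) ≤ |((((y k - z k : ℤ) : ZMod (2 * L + 1))).valMinAbs : ℤ)|) :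
    |torusK3 G r β L x y z| ≤ (2 * C₁ / (M : ℝ) ^ 4) ^ 3 := by
  haveI : NeZero (2 * L + 1) := ⟨by omega⟩
  haveI := isProbabilityMeasure_wilsonMeasure (d := 4) (L := 2 * L + 1) r.ρ r.continuous β
  rw [torusK3_eq_torusE_collar G r β hM hML x y z hxy hxz hyz]
  unfold torusE
  refine abs_integral_le_of_abs_le fun U => ?_
  have hx := abs_collar_le G r β hC₁ hF hM hb hML x (torusLift (2 * L + 1) U)
  have hy := abs_collar_le G r β hC₁ hF hM hb hML y (torusLift (2 * L + 1) U)
  have hz := abs_collar_le G r β hC₁ hF hM hb hML z (torusLift (2 * L + 1) U)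
  have h0 : 0 ≤ 2 * C₁ / (M : ℝ) ^ 4 := by positivity
  rw [abs_mul, abs_mul, pow_three]
  have hxy' := mul_le_mul hx hy (abs_nonneg _) h0
  exact mul_le_mul hxy' hz (abs_nonneg _) (mul_nonneg h0 h0) |>.trans (le_of_eq (by ring))

end Torus


/-! ## §3 Counting lattice points in a Euclidean ball -/

/-- At most `(2ρ+1)⁴` lattice points of any finite set lie within Euclidean distance `ρ` of `z`. [folklore] -/
theorem card_filter_norm_sub_le (S : Finset (Fin 4 → ℤ)) (z : Fin 4 → ℤ) {ρ : ℝ} (hρ : 0 ≤ ρ) :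
    (((S.filter fun x => ‖siteToE (x - z)‖ ≤ ρ).card : ℕ) : ℝ) ≤ (2 * ρ + 1) ^ 4 := by
  classical
  set N : ℕ := ⌊ρ⌋₊ with hN
  set T : Finset (Fin 4 → ℤ) := Fintype.piFinset fun _ : Fin 4 => Finset.Icc (-(N : ℤ)) N with hT
  have hmaps : ∀ x ∈ S.filter (fun x => ‖siteToE (x - z)‖ ≤ ρ), x - z ∈ T := by
    intro x hx
    rw [Finset.mem_filter] at hx
    rw [hT, Fintype.mem_piFinset]
    intro k
    rw [Finset.mem_Icc]
    have h1 : |(((x - z) k : ℤ) : ℝ)| ≤ ρ := by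
      have h := PiLp.norm_apply_le (siteToE (x - z)) k
      rw [siteToE_apply, Real.norm_eq_abs] at h
      exact h.trans hx.2
    have h2 : |(x - z) k| ≤ (N : ℤ) := by
      have h3 : ((|(x - z) k| : ℤ) : ℝ) ≤ ρ := by push_cast; exact h1
      have h5 : ((|(x - z) k| : ℤ) : ℝ) < (N : ℝ) + 1 := h3.trans_lt (by rw [hN]; exact Nat.lt_floor_add_one ρ)
      have h6 : (|(x - z) k| : ℤ) < (N : ℤ) + 1 := by exact_mod_cast h5
      omega
    exact abs_le.1 h2
  have hinj : Set.InjOn (fun x : Fin 4 → ℤ => x - z) (S.filter fun x => ‖siteToE (x - z)‖ ≤ ρ) :=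
    fun x _ x' _ h => sub_left_injective h
  have hcard := Finset.card_le_card_of_injOn (fun x => x - z) hmaps hinj
  have hTcard : T.card = (2 * N + 1) ^ 4 := by
    rw [hT, Fintype.card_piFinset, Finset.prod_const, Finset.card_univ, Fintype.card_fin, Int.card_Icc]
    congr 1
    omega
  rw [hTcard] at hcard
  calc (((S.filter fun x => ‖siteToE (x - z)‖ ≤ ρ).card : ℕ) : ℝ) ≤ ((2 * N + 1) ^ 4 : ℕ) := by exact_mod_cast hcard
    _ = (2 * (N : ℝ) + 1) ^ 4 := by push_cast; ring
    _ ≤ (2 * ρ + 1) ^ 4 := by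
        have : (N : ℝ) ≤ ρ := Nat.floor_le hρ
        gcongr

/-- A coordinate of size `≥ 2M+4` and `≤ L` gives the torus separation hypothesis of the collar bounds. [folklore] -/
theorem sep_of_coord (L M : ℕ) (x z : Fin 4 → ℤ) (k : Fin 4) (h1 : (2 * (M : ℤ) + 4) ≤ |x k - z k|) (h2 : |x k - z k| ≤ L) :
    ∃ k : Fin 4, (2 * (M : ℤ) + 4) ≤ |((((x k - z k : ℤ) : ZMod (2 * L + 1))).valMinAbs : ℤ)| :=
  ⟨k, by rw [Summit.QuantumFields.YangMills.Cruxes.UVSeamRec.TemperedResponse.valMinAbs_intCast_of_abs_le L h2]; exact h1⟩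


/-! ## §4 The lattice ball of physical radius `ρ` at spacing `t` as a finite set -/

/-- Membership in the lattice ball `{w : t‖w‖ < ρ}` realised inside the box of radius `⌊ρ/t⌋`. [folklore] -/
theorem mem_ballFinset {t ρ : ℝ} (ht : 0 < t) (w : Fin 4 → ℤ) (hw : t * ‖siteToE w‖ < ρ) :
    w ∈ (Fintype.piFinset fun _ : Fin 4 => Finset.Icc (-(⌊ρ / t⌋₊ : ℤ)) ⌊ρ / t⌋₊).filter
      (fun w => t * ‖siteToE w‖ < ρ) := by
  rw [Finset.mem_filter]
  refine ⟨?_, hw⟩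
  rw [Fintype.mem_piFinset]
  intro k
  rw [Finset.mem_Icc]
  have h0 : ‖siteToE w‖ < ρ / t := by rw [lt_div_iff₀ ht, mul_comm]; exact hw
  have h1 : |((w k : ℤ) : ℝ)| < ρ / t := by
    have h := PiLp.norm_apply_le (siteToE w) k
    rw [siteToE_apply, Real.norm_eq_abs] at h
    exact h.trans_lt h0
  have h2 : |w k| ≤ (⌊ρ / t⌋₊ : ℤ) := by
    have h3 : ((|w k| : ℤ) : ℝ) < ρ / t := by push_cast; exact h1
    have h5 : ((|w k| : ℤ) : ℝ) < (⌊ρ / t⌋₊ : ℝ) + 1 := h3.trans (Nat.lt_floor_add_one _)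
    have h6 : (|w k| : ℤ) < (⌊ρ / t⌋₊ : ℤ) + 1 := by exact_mod_cast h5
    omega
  exact abs_le.1 h2

/-- The lattice ball `{w : t‖w‖ < ρ}` has at most `(2ρ/t + 1)⁴` points. [folklore] -/
theorem card_ballFinset_le {t ρ : ℝ} (ht : 0 < t) (hρ : 0 ≤ ρ) :
    ((((Fintype.piFinset fun _ : Fin 4 => Finset.Icc (-(⌊ρ / t⌋₊ : ℤ)) ⌊ρ / t⌋₊).filter
      (fun w => t * ‖siteToE w‖ < ρ)).card : ℕ) : ℝ) ≤ (2 * (ρ / t) + 1) ^ 4 := by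
  set K : ℕ := ⌊ρ / t⌋₊ with hK
  have h1 : ((Fintype.piFinset fun _ : Fin 4 => Finset.Icc (-(K : ℤ)) K).filter (fun w => t * ‖siteToE w‖ < ρ)).card ≤
      (Fintype.piFinset fun _ : Fin 4 => Finset.Icc (-(K : ℤ)) K).card := Finset.card_filter_le _ _
  have h2 : (Fintype.piFinset fun _ : Fin 4 => Finset.Icc (-(K : ℤ)) K).card = (2 * K + 1) ^ 4 := by
    rw [Fintype.card_piFinset, Finset.prod_const, Finset.card_univ, Fintype.card_fin, Int.card_Icc]
    congr 1
    omega
  rw [h2] at h1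
  calc ((((Fintype.piFinset fun _ : Fin 4 => Finset.Icc (-(K : ℤ)) K).filter (fun w => t * ‖siteToE w‖ < ρ)).card : ℕ) : ℝ)
      ≤ ((2 * K + 1) ^ 4 : ℕ) := by exact_mod_cast h1
    _ = (2 * (K : ℝ) + 1) ^ 4 := by push_cast; ring
    _ ≤ (2 * (ρ / t) + 1) ^ 4 := by
        have : (K : ℝ) ≤ ρ / t := Nat.floor_le (div_nonneg hρ ht.le)
        gcongr

end Summit.QuantumFields.YangMills.Cruxes.ResponseLocalisation.Signed

end
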